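import Summits.MatrixMultiplication.OmegaCensus.AffineExtension

/-!
# ω-census, family (b3): `3 × 3` boxes of `A ⋊_φ ℤ/n` — the key identity and the COSET-PATTERN lemma

HONEST FRAMING (pub-omega census; verbatim): lottery ticket; floor = certified bounds/negative ranges.
Census BOOKKEEPING (conjecture C9 of the cell, STRUCTURE.md §2; pub-omega kernel-l4 gen 18, task K-8).  This is the verbatim
generalisation of `MetacyclicBoxPattern.lean` / `RingMetaCyclic.lean` (`ABox`, `RBox`) from `ℤ/N ⋊_u ℤ/q` to the affine extension
`AffExt A n φ = A ⋊_φ ℤ/n` of `AffineExtension.lean`, with ONE addition that is the point of the whole exercise: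
* `AffExt.ABox` — box data `y_i = (yv i, ye i)`, `w_j = (wv j, we j)` together with a *gauge* `sh : column → A` (a shift of the
  coordinate of each column; it changes nothing in the group, but lets the forbidden differences be written in reduced form);
* `ABox.cell c a t = (φ^{−σ(c)} a − sh c, t)` — the cell of column `c = (i,j)` (`σ(c) = ye i + we j`) at *coordinate* `a : A` and
  level `t`; KEY IDENTITY `ABox.cellWord_cell`: two cells interact (`cellWord = 1`) only if `t' = t + σ(c) − σ(c')` and
  `a = a' + DD c c'` with the forbidden difference
  `DD c c' = φ^{σ c} (sh c) − φ^{σ c'} (sh c') − φ^{σ c'} (yv i) + φ^{ye i + we j'} (yv i') − φ^{ye i + we j'} (wv j) + φ^{σ c} (wv j')`;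
* **COSET PATTERNS** (`ABox.not_boxUseful_of_cosetPattern`): for a surjective additive `λ : A →+ P` and column sets
  `S c ⊆ P`, the cells `{cell c a t : λ a ∈ S c}` — unions of cosets of `ker λ × ℤ/n` — form an independent set as soon as
  `z ≠ z' + λ(DD c c')` for `z ∈ S c`, `z' ∈ S c'`, `c ≠ c'`; it has `|ker λ| · n · Σ_c #(S c)` cells, so
  `9 |P| ≤ 5 Σ_c #(S c)` makes `A ⋊_φ ℤ/n` not box-useful.  The point: the validity condition lives in the SMALL group `P`
  and involves only the values `λ(DD c c')`, which for the boxes of `AffineExtensionBoxF1/F2.lean` are free parameters —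
  one finite pattern in `P = ℤ/p` then serves every `A`, every `φ`, every `n`.
Pure algebra; nothing here is progress on `ω`.
-/

namespace Summit.MatrixMultiplication.OmegaCensus

open Finset ProductBoxBound

namespace AffExt

variable {A : Type*} [AddCommGroup A] {n : ℕ} {φ : AddMonoid.End A}

/-- Box data for `AffExt A n φ` with a gauge: `y_i = (yv i, ye i)`, `w_j = (wv j, we j)`, and a coordinate shift `sh c` for
every column `c`. [folklore] -/
structure ABox (A : Type*) [AddCommGroup A] (n : ℕ) where
  /-- `A`-parts of `y₀, y₁, y₂` -/
  yv : Fin 3 → A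
  /-- `ℤ/n`-parts of `y₀, y₁, y₂` -/
  ye : Fin 3 → ZMod n
  /-- `A`-parts of `w₀, w₁, w₂` -/
  wv : Fin 3 → A
  /-- `ℤ/n`-parts of `w₀, w₁, w₂` -/
  we : Fin 3 → ZMod n
  /-- the gauge: coordinate shift of column `c` -/
  sh : Fin 3 × Fin 3 → A

namespace ABox

variable (D : ABox A n) (φ)

/-- The `Y`-element `y_i`. [folklore] -/
def yEl (i : Fin 3) : AffExt A n φ := ⟨D.yv i, D.ye i⟩

/-- The `W`-element `w_j`. [folklore] -/
def wEl (j : Fin 3) : AffExt A n φ := ⟨D.wv j, D.we j⟩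

/-- The level sum `σ(c) = ye i + we j` of the column `c = (i, j)`. [folklore] -/
def sig (c : Fin 3 × Fin 3) : ZMod n := D.ye c.1 + D.we c.2

/-- The forbidden coordinate difference from column `c = (i,j)` to column `c' = (i',j')`. [folklore] -/
def DD (c c' : Fin 3 × Fin 3) : A :=
  act φ (D.sig c) (D.sh c) - act φ (D.sig c') (D.sh c') - act φ (D.sig c') (D.yv c.1)
    + act φ (D.ye c.1 + D.we c'.2) (D.yv c'.1) - act φ (D.ye c.1 + D.we c'.2) (D.wv c.2) + act φ (D.sig c) (D.wv c'.2)

/-- The cell of column `c` at coordinate `a` and level `t`: `(φ^{−σ(c)} a − sh c, t)`. [folklore] -/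
def cell (c : Fin 3 × Fin 3) (a : A) (t : ZMod n) : AffExt A n φ × AffExt A n φ × AffExt A n φ :=
  (⟨act φ (-D.sig c) a - D.sh c, t⟩, D.yEl φ c.1, D.wEl φ c.2)

/-- `DD c c = 0`. [folklore] -/
theorem DD_self (c : Fin 3 × Fin 3) : D.DD φ c c = 0 := by
  simp only [DD, sig]; abel

/-- The `ℤ/n`-part of a cell word is the signed sum of the levels. [folklore] -/
theorem cellWord_t [NeZero n] [Fact (φ ^ n = 1)] (x y w x' y' w' : AffExt A n φ) :
    (cellWord (x, y, w) (x', y', w')).t = x.t + -x'.t + (y.t + -y'.t) + (w.t + -w'.t) := by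
  simp only [cellWord, AffExt.mul_def, AffExt.inv_def]

/-- The `A`-part of a cell word, powers of `φ` collected. [folklore] -/
theorem cellWord_v [NeZero n] [Fact (φ ^ n = 1)] (x y w x' y' w' : AffExt A n φ) :
    (cellWord (x, y, w) (x', y', w')).v =
      x.v + -act φ (x.t + -x'.t) x'.v
        + act φ (x.t + -x'.t) (y.v + -act φ (y.t + -y'.t) y'.v)
        + act φ (x.t + -x'.t + (y.t + -y'.t)) (w.v + -act φ (w.t + -w'.t) w'.v) := by
  have hφ : φ ^ n = 1 := Fact.out
  simp only [cellWord, AffExt.mul_def, AffExt.inv_def, map_add, map_neg, act_act hφ]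

/-- `φˢ v = φᵗ v` when `s = t`. [folklore] -/
theorem act_congr {s t : ZMod n} (h : s = t) (v : A) : act φ s v = act φ t v := by rw [h]

/-- **Key identity.** Two cells interact only if their levels differ by `σ(c) − σ(c')` and their coordinates by `DD c c'`.
[folklore] -/
theorem cellWord_cell [NeZero n] [Fact (φ ^ n = 1)] {c c' : Fin 3 × Fin 3} {a a' : A} {t t' : ZMod n}
    (hw : cellWord (D.cell φ c a t) (D.cell φ c' a' t') = 1) :
    t' = t + D.sig c - D.sig c' ∧ a = a' + D.DD φ c c' := by
  have hφ : φ ^ n = 1 := Fact.out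
  have ht := congrArg AffExt.t hw
  have hv := congrArg AffExt.v hw
  rw [cell, cell, cellWord_t] at ht
  rw [cell, cell, cellWord_v] at hv
  simp only [yEl, wEl, AffExt.one_def, sig] at ht hv ⊢
  have et : t' = t + (D.ye c.1 + D.we c.2) - (D.ye c'.1 + D.we c'.2) := by linear_combination -ht
  refine ⟨et, ?_⟩
  subst et
  have h3 := congrArg (act φ (D.ye c.1 + D.we c.2)) hv
  simp only [map_add, map_neg, map_sub, map_zero, act_act hφ] at h3
  -- normalise the exponents
  have e1 : D.ye c.1 + D.we c.2 + -(D.ye c.1 + D.we c.2) = 0 := by ring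
  have e2 : D.ye c.1 + D.we c.2 + (t + -(t + (D.ye c.1 + D.we c.2) - (D.ye c'.1 + D.we c'.2)) + -(D.ye c'.1 + D.we c'.2))
      = 0 := by ring
  have e3 : D.ye c.1 + D.we c.2 + (t + -(t + (D.ye c.1 + D.we c.2) - (D.ye c'.1 + D.we c'.2)))
      = D.ye c'.1 + D.we c'.2 := by ring
  have e4 : D.ye c.1 + D.we c.2 + (t + -(t + (D.ye c.1 + D.we c.2) - (D.ye c'.1 + D.we c'.2)) + (D.ye c.1 + -D.ye c'.1))
      = D.ye c.1 + D.we c'.2 := by ring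
  have e5 : D.ye c.1 + D.we c.2 + (t + -(t + (D.ye c.1 + D.we c.2) - (D.ye c'.1 + D.we c'.2)) + (D.ye c.1 + -D.ye c'.1)
      + (D.we c.2 + -D.we c'.2)) = D.ye c.1 + D.we c.2 := by ring
  rw [act_congr φ e1, act_congr φ e2, act_zero_apply, act_zero_apply, act_congr φ e3, act_congr φ e4,
    act_congr φ e5] at h3
  rw [DD, sig, sig, ← sub_eq_zero, ← h3]
  abel

/-- The injectivity data of a nondegenerate box: the three `Y`-elements and the three `W`-elements are distinct. [folklore] -/
structure Nondeg : Prop where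
  /-- the three `Y`-elements are distinct -/
  y_inj : Function.Injective (D.yEl φ)
  /-- the three `W`-elements are distinct -/
  w_inj : Function.Injective (D.wEl φ)

/-- Nondegeneracy from the injectivity of the two data maps `i ↦ (yv i, ye i)`, `j ↦ (wv j, we j)`. [folklore] -/
theorem nondeg_of (hy : Function.Injective fun i => (D.yv i, D.ye i)) (hw : Function.Injective fun j => (D.wv j, D.we j)) :
    D.Nondeg φ :=
  ⟨fun i i' e => hy (by simp only [yEl, AffExt.mk.injEq] at e; exact Prod.ext e.1 e.2),
    fun j j' e => hw (by simp only [wEl, AffExt.mk.injEq] at e; exact Prod.ext e.1 e.2)⟩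

/-- `φᵗ` is injective on `A` (`φ ^ n = 1`). [folklore] -/
theorem act_cancel [NeZero n] (hφ : φ ^ n = 1) (s : ZMod n) {a a' : A} (h : act φ s a = act φ s a') : a = a' := by
  have := congrArg (act φ (-s)) h
  rwa [act_act hφ, act_act hφ, neg_add_cancel, act_zero_apply, act_zero_apply] at this

/-- Cells determine their data (for a nondegenerate box). [folklore] -/
theorem cell_inj [NeZero n] [Fact (φ ^ n = 1)] (hD : D.Nondeg φ) {c c' : Fin 3 × Fin 3} {a a' : A}
    {t t' : ZMod n} (e : D.cell φ c a t = D.cell φ c' a' t') : c = c' ∧ a = a' ∧ t = t' := by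
  simp only [cell, Prod.mk.injEq, AffExt.mk.injEq] at e
  obtain ⟨⟨e1, e2⟩, ey, ew⟩ := e
  have hc : c = c' := Prod.ext (hD.y_inj ey) (hD.w_inj ew)
  subst hc
  exact ⟨rfl, act_cancel φ Fact.out _ (sub_left_injective e1), e2⟩

/-! ### Coset patterns -/

variable {P : Type*} [AddCommGroup P] [DecidableEq P] (lam : A →+ P) (S : Fin 3 × Fin 3 → Finset P)
variable [Fintype A] [DecidableEq A] [NeZero n] [Fact (φ ^ n = 1)]

/-- The coordinate pattern of a coset pattern: all `(c, a)` with `λ a ∈ S c`. [folklore] -/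
def coords : Finset ((Fin 3 × Fin 3) × A) := univ.filter fun x => lam x.2 ∈ S x.1

/-- The cell set of a coset pattern: over every `(c, a)` with `λ a ∈ S c`, the `n` cells of column `c` at coordinate `a`.
[folklore] -/
def cellSet : Finset (AffExt A n φ × AffExt A n φ × AffExt A n φ) :=
  (coords lam S).biUnion fun x => (univ : Finset (ZMod n)).image fun t => D.cell φ x.1 x.2 t

omit [Fintype A] [DecidableEq A] [NeZero n] [Fact (φ ^ n = 1)] in
/-- Membership in the coordinate pattern. [folklore] -/
theorem mem_coords [Fintype A] {x : (Fin 3 × Fin 3) × A} : x ∈ coords lam S ↔ lam x.2 ∈ S x.1 := by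
  simp [coords]

omit [Fact (φ ^ n = 1)] in
/-- Membership in the cell set. [folklore] -/
theorem mem_cellSet {Q : AffExt A n φ × AffExt A n φ × AffExt A n φ} :
    Q ∈ D.cellSet φ lam S ↔ ∃ x ∈ coords lam S, ∃ t : ZMod n, Q = D.cell φ x.1 x.2 t := by
  constructor
  · intro hQ
    obtain ⟨x, hx, hQ⟩ := mem_biUnion.1 hQ
    obtain ⟨t, -, ht⟩ := mem_image.1 hQ
    exact ⟨x, hx, t, ht.symm⟩
  · rintro ⟨x, hx, t, rfl⟩
    exact mem_biUnion.2 ⟨x, hx, mem_image.2 ⟨t, mem_univ _, rfl⟩⟩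

omit [Fact (φ ^ n = 1)] in
/-- The cell set lies in the box `G × Y × W`, `Y = {y_i}`, `W = {w_j}`. [folklore] -/
theorem cellSet_subset : D.cellSet φ lam S ⊆ univ ×ˢ ((univ.image (D.yEl φ)) ×ˢ (univ.image (D.wEl φ))) := by
  intro Q hQ
  obtain ⟨x, -, t, rfl⟩ := (D.mem_cellSet φ lam S).1 hQ
  simp only [cell, mem_product, mem_univ, true_and, mem_image]
  exact ⟨⟨x.1.1, rfl⟩, ⟨x.1.2, rfl⟩⟩

/-- The cell set has `#coords · n` cells (nondegenerate box). [folklore] -/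
theorem card_cellSet (hD : D.Nondeg φ) : #(D.cellSet φ lam S) = #(coords lam S) * n := by
  have hinj : ∀ x : (Fin 3 × Fin 3) × A, Function.Injective (fun t : ZMod n => D.cell φ x.1 x.2 t) := by
    intro x t t' e
    exact (D.cell_inj φ hD e).2.2
  rw [cellSet, card_biUnion]
  · have : ∀ x ∈ coords lam S, #((univ : Finset (ZMod n)).image fun t => D.cell φ x.1 x.2 t) = n := fun x _ => by
      rw [card_image_of_injective _ (hinj x), card_univ, ZMod.card]
    rw [sum_congr rfl this, sum_const, smul_eq_mul]
  · intro x _ y _ hxy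
    rw [Function.onFun, disjoint_left]
    intro Q hQx hQy
    obtain ⟨t, -, rfl⟩ := mem_image.1 hQx
    obtain ⟨t', -, e⟩ := mem_image.1 hQy
    obtain ⟨hc, hA, -⟩ := D.cell_inj φ hD e.symm
    exact hxy (Prod.ext hc hA)

/-- *Validity* of a coset pattern for the box: no `z ∈ S c`, `z' ∈ S c'` (`c ≠ c'`) with `z = z' + λ(DD c c')`. [folklore] -/
def Valid : Prop :=
  ∀ c c' : Fin 3 × Fin 3, c ≠ c' → ∀ z ∈ S c, ∀ z' ∈ S c', z ≠ z' + lam (D.DD φ c c')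

omit [Fintype A] [DecidableEq A] [NeZero n] [Fact (φ ^ n = 1)] in
/-- Validity is decidable. [folklore] -/
instance : Decidable (D.Valid φ lam S) := by
  unfold Valid; infer_instance

omit [Fintype A] [DecidableEq A] in
/-- A valid coset pattern gives an independent cell set. [folklore] -/
theorem cellSet_indep [Fintype A] [DecidableEq A] (hS : D.Valid φ lam S) :
    ∀ Q ∈ D.cellSet φ lam S, ∀ Q' ∈ D.cellSet φ lam S, Q ≠ Q' → cellWord Q Q' ≠ 1 := by
  intro Q hQ Q' hQ' hne hw
  obtain ⟨x, hx, t, rfl⟩ := (D.mem_cellSet φ lam S).1 hQ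
  obtain ⟨y, hy, t', rfl⟩ := (D.mem_cellSet φ lam S).1 hQ'
  obtain ⟨e1, e2⟩ := D.cellWord_cell φ hw
  by_cases hc : x.1 = y.1
  · apply hne
    rw [hc, DD_self, add_zero] at e2
    have h1 : t' = t := by rw [e1, hc]; ring
    rw [h1, show x = y from Prod.ext hc e2]
  · have hz := (mem_coords lam S).1 hx
    have hz' := (mem_coords lam S).1 hy
    exact hS x.1 y.1 hc _ hz _ hz' (by rw [e2, map_add])

omit [DecidableEq A] [NeZero n] [Fact (φ ^ n = 1)] in
/-- All fibres of a homomorphism over points of its image have the cardinality of the kernel. [folklore] -/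
theorem card_fiber {z : P} (hz : ∃ a₀, lam a₀ = z) :
    #(univ.filter fun a : A => lam a = z) = #(univ.filter fun a : A => lam a = 0) := by
  obtain ⟨a₀, rfl⟩ := hz
  refine (card_bij' (fun a _ => a + a₀) (fun a _ => a - a₀) ?_ ?_ ?_ ?_).symm
  · intro a ha
    simp only [mem_filter, mem_univ, true_and] at ha ⊢
    rw [map_add, ha, zero_add]
  · intro a ha
    simp only [mem_filter, mem_univ, true_and] at ha ⊢
    rw [map_sub, ha, sub_self]
  · intro a _; simp
  · intro a _; simp

omit [NeZero n] [Fact (φ ^ n = 1)] in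
/-- The coordinate pattern of a surjective `λ` has `|ker λ| · Σ_c #(S c)` points. [folklore] -/
theorem card_coords (hlam : Function.Surjective lam) :
    #(coords lam S) = #(univ.filter fun a : A => lam a = 0) * ∑ c, #(S c) := by
  have hcol : ∀ c : Fin 3 × Fin 3, #(univ.filter fun a : A => lam a ∈ S c) =
      #(univ.filter fun a : A => lam a = 0) * #(S c) := by
    intro c
    have hmaps : Set.MapsTo (fun a : A => lam a) ↑(univ.filter fun a : A => lam a ∈ S c) ↑(S c) := fun a ha => by
      rw [coe_filter] at ha; exact ha.2
    rw [card_eq_sum_card_fiberwise hmaps]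
    have : ∀ z ∈ S c, #((univ.filter fun a : A => lam a ∈ S c).filter fun a => lam a = z) =
        #(univ.filter fun a : A => lam a = 0) := by
      intro z hz
      rw [← card_fiber lam (hlam z)]
      congr 1
      ext a
      simp only [mem_filter, mem_univ, true_and, and_iff_right_iff_imp]
      intro h; rwa [h]
    rw [sum_congr rfl this, sum_const, smul_eq_mul, mul_comm]
  have hsplit : coords lam S = univ.biUnion fun c : Fin 3 × Fin 3 =>
      (univ.filter fun a : A => lam a ∈ S c).image fun a => (c, a) := by
    ext x
    simp only [coords, mem_filter, mem_univ, true_and, mem_biUnion, mem_image]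
    constructor
    · intro h; exact ⟨x.1, x.2, h, rfl⟩
    · rintro ⟨c, a, ha, rfl⟩; exact ha
  rw [hsplit, card_biUnion]
  · rw [mul_sum]
    refine sum_congr rfl fun c _ => ?_
    rw [card_image_of_injective _ (fun a a' h => (Prod.mk.injEq _ _ _ _ ▸ h).2), hcol]
  · intro c _ c' _ hcc'
    rw [Function.onFun, disjoint_left]
    intro x hx hx'
    obtain ⟨a, -, rfl⟩ := mem_image.1 hx
    obtain ⟨a', -, e⟩ := mem_image.1 hx'
    exact hcc' (congrArg Prod.fst e).symm

omit [DecidableEq A] [NeZero n] [Fact (φ ^ n = 1)] in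
/-- `|A| = |ker λ| · |P|` for a surjective `λ`. [folklore] -/
theorem card_eq_ker_mul [Fintype P] (hlam : Function.Surjective lam) :
    Fintype.card A = #(univ.filter fun a : A => lam a = 0) * Fintype.card P := by
  have hmaps : Set.MapsTo (fun a : A => lam a) ↑(univ : Finset A) ↑(univ : Finset P) := fun a _ => by
    rw [coe_univ]; exact Set.mem_univ _
  rw [← card_univ, card_eq_sum_card_fiberwise hmaps]
  have : ∀ z ∈ (univ : Finset P), #((univ : Finset A).filter fun a => lam a = z) =
      #(univ.filter fun a : A => lam a = 0) := fun z _ => card_fiber lam (hlam z)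
  rw [sum_congr rfl this, sum_const, smul_eq_mul, card_univ, mul_comm]

/-- **Witness form of the coset-pattern lemma**: a valid coset pattern for a nondegenerate box and a surjective `λ` gives a
`3 × 3` box of `A ⋊_φ ℤ/n` with an independent cell set of exactly `|ker λ| · (Σ_c #(S c)) · n` cells. [folklore] -/
theorem exists_indep_of_cosetPattern (hD : D.Nondeg φ) (hlam : Function.Surjective lam) (hS : D.Valid φ lam S) :
    ∃ (Y W : Finset (AffExt A n φ)) (I : Finset (AffExt A n φ × AffExt A n φ × AffExt A n φ)),
      #Y = 3 ∧ #W = 3 ∧ I ⊆ univ ×ˢ (Y ×ˢ W) ∧ (∀ Q ∈ I, ∀ Q' ∈ I, Q ≠ Q' → cellWord Q Q' ≠ 1) ∧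
        #I = #(univ.filter fun a : A => lam a = 0) * (∑ c, #(S c)) * n :=
  ⟨univ.image (D.yEl φ), univ.image (D.wEl φ), D.cellSet φ lam S,
    by rw [card_image_of_injective _ hD.y_inj, card_univ, Fintype.card_fin],
    by rw [card_image_of_injective _ hD.w_inj, card_univ, Fintype.card_fin],
    D.cellSet_subset φ lam S, D.cellSet_indep φ lam S hS, by rw [D.card_cellSet φ lam S hD, card_coords lam S hlam]⟩

/-- **The coset-pattern lemma**: a valid coset pattern with `9 |P| ≤ 5 Σ_c #(S c)` (surjective `λ`, nondegenerate box) makes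
`A ⋊_φ ℤ/n` not box-useful. [folklore] -/
theorem not_boxUseful_of_cosetPattern [Fintype P] (hD : D.Nondeg φ) (hlam : Function.Surjective lam)
    (hS : D.Valid φ lam S) (hbig : 9 * Fintype.card P ≤ 5 * ∑ c, #(S c)) : ¬ BoxUseful (AffExt A n φ) := by
  obtain ⟨Y, W, I, hY, hW, hI, hind, hcard⟩ := D.exists_indep_of_cosetPattern φ lam S hD hlam hS
  refine not_boxUseful_of_indep hY hW hI hind ?_
  rw [hcard, AffExt.card, card_eq_ker_mul lam hlam]
  set K := #(univ.filter fun a : A => lam a = 0)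
  calc 9 * (K * Fintype.card P * n) = (9 * Fintype.card P) * K * n := by ring
    _ ≤ (5 * ∑ c, #(S c)) * K * n := Nat.mul_le_mul_right _ (Nat.mul_le_mul_right _ hbig)
    _ = 5 * (K * (∑ c, #(S c)) * n) := by ring

/-- Along an injection `A ⋊_φ ℤ/n ↪ G`, a valid coset pattern with `9 |P| ≤ 5 Σ_c #(S c)` makes `G` not box-useful. [folklore] -/
theorem not_boxUseful_of_injective_of_cosetPattern [Fintype P] (hD : D.Nondeg φ) (hlam : Function.Surjective lam)
    (hS : D.Valid φ lam S) (hbig : 9 * Fintype.card P ≤ 5 * ∑ c, #(S c)) {G : Type*} [Group G] [Fintype G] [DecidableEq G]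
    (f : AffExt A n φ →* G) (hf : Function.Injective f) : ¬ BoxUseful G := by
  obtain ⟨Y, W, I, hY, hW, hI, hind, hcard⟩ := D.exists_indep_of_cosetPattern φ lam S hD hlam hS
  refine not_boxUseful_of_injective f hf hY hW hI hind ?_
  rw [hcard, AffExt.card, card_eq_ker_mul lam hlam]
  set K := #(univ.filter fun a : A => lam a = 0)
  calc 9 * (K * Fintype.card P * n) = (9 * Fintype.card P) * K * n := by ring
    _ ≤ (5 * ∑ c, #(S c)) * K * n := Nat.mul_le_mul_right _ (Nat.mul_le_mul_right _ hbig)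
    _ = 5 * (K * (∑ c, #(S c)) * n) := by ring

end ABox

end AffExt

end Summit.MatrixMultiplication.OmegaCensus
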